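import Summits.AtomisticToContinuum.HydrodynamicLimit.Theorems.DenseExcursion.Negative.CompressionBudget

/-!
# No polynomial compression on a σ-uniform compression budget (EOS-free maximum principle)

Negative knowledge for the crux `ImplosionDichotomy.PolynomialCompression` (stmt-AtomisticToContinuum-12587), from the
standing disprover's `Cruxes/PolynomialCompression/Disproof.lean` §12 (cycle 4), porting the sibling crux's
`DenseExcursion/Negative/CompressionBudget.lean` (maximum principle for the continuity equation:
`-K ≤ div u` on `[0,t] × 𝕋³` ⇒ `ρ(t,x) ≤ max ρ(0,·) e^{Kt}`, for EVERY `σ` and every pressure law). With the pinned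
admissible datum `ρ(0) = rhoLim < (2e+1)M` (`DenseExcursion/Negative/AtTimeZero.lean`) two natural strengthenings of
the crux are FALSE, unconditionally: `PolynomialCompressionBoundedCompression` (the witnesses reach `σ^(-κ)` at a time
`t ≤ T₀` with `-K ≤ div u` on `[0,t] × 𝕋³`, `K, T₀` independent of `σ`) and `PolynomialCompressionLipschitzVelocity`
(a σ-uniform velocity-gradient bound `‖Du‖ ≤ M` up to the compression time). So every witness family of the crux has
`sup_{s ≤ t} ‖(div u_σ(s))₋‖_∞ · t ≥ κ log σ⁻¹ − O(1)`: the velocity gradient must blow up (at least logarithmically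
in `σ`) from the FIXED datum `u₀` before the density `σ^(-κ)` is reached — consistent with the intended Type-I
implosion (`div u ∼ −(T*−t)⁻¹`, `∫ ‖div u‖∞ ∼ log`), and ruling out any witness mechanism with σ-uniformly
Lipschitz velocities. refuter-cdisprove-stmt-AtomisticToContinuum-12587-g4-0.
-/

noncomputable section

namespace Summit.AtomisticToContinuum.HydrodynamicLimit.Theorems

open MeasureTheory Filter Set Topology
open scoped ENNReal InnerProductSpace
open Literature.MathematicalPhysics.KineticTheory Literature.Analysis.FluidPDE
open Literature.Analysis.FunctionSpaces

/-- The crux `PolynomialCompression` strengthened by a `σ`-UNIFORM COMPRESSION BUDGET: the witnesses reach density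
`σ^(-κ)` at a time `t ≤ T₀` with `-K ≤ div u` on `[0, t] × 𝕋³`, `K, T₀` independent of `σ` (all else verbatim). -/
def PolynomialCompressionBoundedCompression : Prop :=
  ∃ K T₀ : ℝ, ∃ κ : ℝ, 0 < κ ∧ ∃ (a₀ θ₀ : Literature.MathematicalPhysics.KineticTheory.T3 → ℝ) (u₀ : Literature.MathematicalPhysics.KineticTheory.T3 → Literature.MathematicalPhysics.KineticTheory.V3), Continuous a₀ ∧ Continuous θ₀ ∧ Continuous u₀ ∧ (∀ x, 0 < a₀ x) ∧ (∀ x, 0 < θ₀ x) ∧ ∀ σ₀ : ℝ, 0 < σ₀ → ∃ σ : ℝ, 0 < σ ∧ σ < σ₀ ∧ ∃ (T : ℝ) (ρ θ : ℝ → Literature.MathematicalPhysics.KineticTheory.T3 → ℝ) (u : ℝ → Literature.MathematicalPhysics.KineticTheory.T3 → Literature.MathematicalPhysics.KineticTheory.V3), Literature.MathematicalPhysics.KineticTheory.IsHardSphereEulerSolution σ T ρ u θ ∧ (∀ Φ : (N : ℕ) → Literature.Analysis.FluidPDE.HardSphereFlow (Literature.Analysis.FluidPDE.Torus.geometry (Fin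 3)) (Literature.MathematicalPhysics.KineticTheory.hsDiameter σ N) (N + 1), Literature.MathematicalPhysics.KineticTheory.TendstoHydroFieldsAt (fun N => Literature.MathematicalPhysics.KineticTheory.localGibbsLaw σ a₀ u₀ θ₀ N (Φ N)) Φ ρ u θ 0) ∧ ∃ t ∈ Set.Ico 0 T, t ≤ T₀ ∧ (∀ s ∈ Set.Icc 0 t, ∀ x, -K ≤ Literature.Analysis.FunctionSpaces.Torus.divergence (u s) x) ∧ ∃ x, σ ^ (-κ) ≤ ρ t x

/-- The crux `PolynomialCompression` strengthened by a `σ`-UNIFORM VELOCITY-GRADIENT BOUND up to the compression time: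
`‖Du(s, x)‖ ≤ M` on `[0, t] × 𝕋³` with `t ≤ T₀`, `M, T₀` independent of `σ` (all else verbatim). -/
def PolynomialCompressionLipschitzVelocity : Prop :=
  ∃ M T₀ : ℝ, ∃ κ : ℝ, 0 < κ ∧ ∃ (a₀ θ₀ : Literature.MathematicalPhysics.KineticTheory.T3 → ℝ) (u₀ : Literature.MathematicalPhysics.KineticTheory.T3 → Literature.MathematicalPhysics.KineticTheory.V3), Continuous a₀ ∧ Continuous θ₀ ∧ Continuous u₀ ∧ (∀ x, 0 < a₀ x) ∧ (∀ x, 0 < θ₀ x) ∧ ∀ σ₀ : ℝ, 0 < σ₀ → ∃ σ : ℝ, 0 < σ ∧ σ < σ₀ ∧ ∃ (T : ℝ) (ρ θ : ℝ → Literature.MathematicalPhysics.KineticTheory.T3 → ℝ) (u : ℝ → Literature.MathematicalPhysics.KineticTheory.T3 → Literature.MathematicalPhysics.KineticTheory.V3), Literature.MathematicalPhysics.KineticTheory.IsHardSphereEulerSolution σ T ρ u θ ∧ (∀ Φ : (N : ℕ) → Literature.Analysis.FluidPDE.HardSphereFlow (Literature.Analysis.FluidPDE.Torus.geometry (Fin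 3)) (Literature.MathematicalPhysics.KineticTheory.hsDiameter σ N) (N + 1), Literature.MathematicalPhysics.KineticTheory.TendstoHydroFieldsAt (fun N => Literature.MathematicalPhysics.KineticTheory.localGibbsLaw σ a₀ u₀ θ₀ N (Φ N)) Φ ρ u θ 0) ∧ ∃ t ∈ Set.Ico 0 T, t ≤ T₀ ∧ (∀ s ∈ Set.Icc 0 t, ∀ x, ‖Literature.Analysis.FunctionSpaces.Torus.fderiv (u s) x‖ ≤ M) ∧ ∃ x, σ ^ (-κ) ≤ ρ t x

/-- Both are strengthenings of the crux (drop the budget clauses). [folklore] -/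
theorem polynomialCompression_of_boundedCompression (h : PolynomialCompressionBoundedCompression) :
    Summit.AtomisticToContinuum.HydrodynamicLimit.Theses.ImplosionDichotomy.PolynomialCompression := by
  obtain ⟨K, T₀, κ, hκ, a₀, θ₀, u₀, ha, hθ, hu, ha0, hθ0, H⟩ := h
  refine ⟨κ, hκ, a₀, θ₀, u₀, ha, hθ, hu, ha0, hθ0, fun σ₀ hσ₀ => ?_⟩
  obtain ⟨σ, hσ, hσlt, T, ρ, θ, u, hE, hA, t, ht, -, -, x, hx⟩ := H σ₀ hσ₀
  exact ⟨σ, hσ, hσlt, T, ρ, θ, u, hE, hA, t, ht, x, hx⟩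

open DenseExcursionCompressionBudget DenseExcursionAtTimeZero in
/-- **NO POLYNOMIAL COMPRESSION ON A BOUNDED COMPRESSION BUDGET** (unconditional, EOS-free): with `-K ≤ div u` up to the
compression time `t ≤ T₀`, `K, T₀` independent of `σ`, the density of an admissible classical solution is
`< (2e+1) M e^{|K| T₀}`, a constant of the profiles, while `σ^(-κ) → ∞` (data pinning `ρ(0) = rhoLim < (2e+1)M`,
Alexander for a flow family to test through, and the maximum principle for the continuity equation). [folklore] -/
theorem polynomialCompression_false_boundedCompression : ¬ PolynomialCompressionBoundedCompression := by
  rintro ⟨K, T₀, κ, hκ, a₀, θ₀, u₀, ha, hθ, hu, ha0, hθ0, H⟩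
  obtain ⟨σ₁, hσ₁, hσ₁2, G⟩ := density_zero_eq_rhoLim ha hθ hu ha0 hθ0
  set P := profileOf a₀ ha ha0 with hP
  set B := (2 * Real.exp 1 + 1) * P.M * Real.exp (|K| * T₀) with hB
  have hB0 : 0 < B := by have := P.M_pos; positivity
  have hB1 : 0 < max B 1 := hB0.trans_le (le_max_left _ _)
  -- below `σ₂ := (max B 1)^(-1/κ)` the target `σ^(-κ)` exceeds `B`
  set σ₂ : ℝ := (max B 1) ^ (-κ⁻¹) with hσ₂
  have hσ₂0 : 0 < σ₂ := Real.rpow_pos_of_pos hB1 _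
  obtain ⟨σ, hσ, hσlt, T, ρ, θ, u, hE, hA, t, ht, htT₀, hK, x, hx⟩ :=
    H (min σ₁ σ₂) (lt_min hσ₁ hσ₂0)
  have hσ1 : σ < σ₁ := lt_of_lt_of_le hσlt (min_le_left _ _)
  have hσσ₂ : σ < σ₂ := lt_of_lt_of_le hσlt (min_le_right _ _)
  have hσ2 : σ < 1 / 2 := hσ1.trans_le hσ₁2
  obtain ⟨hS, G'⟩ := G σ hσ hσ1
  obtain ⟨Φ⟩ : Nonempty ((N : ℕ) → HardSphereFlow (Torus.geometry (Fin 3)) (hsDiameter σ N) (N + 1)) :=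
    ⟨fun N => Classical.choice (HardSphereFlow.nonempty_torus_holds (d := Fin 3)
      (hsDiameter_pos hσ N) ((hsDiameter_le hσ.le N).trans_lt (hσ2.trans_eq (by norm_num))) (N + 1))⟩
  have hT : 0 < T := ht.1.trans_lt ht.2
  have h0 : (0 : ℝ) ∈ Ico 0 T := ⟨le_rfl, hT⟩
  have hρ0 : ρ 0 = rhoLim P σ :=
    G' ρ θ u Φ (hE.smooth_density.isSmooth_slice h0).continuous (hA Φ)
  -- maximum principle + pinned data: `ρ t x < B`
  obtain ⟨y, hy⟩ := density_le_max_mul_exp hE ht hK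
  have hlt0 : ρ 0 y < (2 * Real.exp 1 + 1) * P.M := by rw [hρ0]; exact rhoLim_lt hS y
  have hKt : K * t ≤ |K| * T₀ :=
    (mul_le_mul_of_nonneg_right (le_abs_self K) ht.1).trans (mul_le_mul_of_nonneg_left htT₀ (abs_nonneg K))
  have hρB : ρ t x < B := by
    have hexp : 0 < Real.exp (K * t) := Real.exp_pos _
    have := P.M_pos
    calc ρ t x ≤ ρ 0 y * Real.exp (K * t) := hy x
      _ < (2 * Real.exp 1 + 1) * P.M * Real.exp (K * t) := by gcongr
      _ ≤ B := by rw [hB]; gcongr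
  -- but `σ^(-κ) ≥ max B 1 ≥ B`
  have hge : max B 1 ≤ σ ^ (-κ) := by
    have h1 := Real.rpow_le_rpow_of_nonpos hσ hσσ₂.le (by linarith [hκ] : -κ ≤ 0)
    rwa [hσ₂, ← Real.rpow_mul hB1.le, neg_mul_neg, inv_mul_cancel₀ hκ.ne', Real.rpow_one] at h1
  have : ρ t x < σ ^ (-κ) := hρB.trans_le ((le_max_left _ _).trans hge)
  exact absurd hx (not_le.2 this)

open DenseExcursionCompressionBudget in
/-- **NO POLYNOMIAL COMPRESSION INSIDE A `σ`-UNIFORM `C¹` REGIME OF THE VELOCITY** (unconditional): `‖Du‖ ≤ M` gives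
`-3M ≤ div u`, and `polynomialCompression_false_boundedCompression` applies. Hence every witness family of the crux has
`sup_{s ≤ t}‖(div u_σ(s))₋‖∞ · t ≥ κ log σ⁻¹ − O(1)` before the compression time. [folklore] -/
theorem polynomialCompression_false_lipschitzVelocity : ¬ PolynomialCompressionLipschitzVelocity := by
  rintro ⟨M, T₀, κ, hκ, a₀, θ₀, u₀, ha, hθ, hu, ha0, hθ0, H⟩
  refine polynomialCompression_false_boundedCompression ⟨3 * M, T₀, κ, hκ, a₀, θ₀, u₀, ha, hθ, hu, ha0, hθ0,
    fun σ₀ hσ₀ => ?_⟩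
  obtain ⟨σ, hσ, hσlt, T, ρ, θ, u, hE, hA, t, ht, htT₀, hM, x, hx⟩ := H σ₀ hσ₀
  refine ⟨σ, hσ, hσlt, T, ρ, θ, u, hE, hA, t, ht, htT₀, fun s hs z => ?_, x, hx⟩
  have hsT : s ∈ Ico 0 T := ⟨hs.1, hs.2.trans_lt ht.2⟩
  have h1 : Torus.IsContDiff 1 (u s) := (hE.smooth_velocity.isSmooth_slice hsT).isContDiff (by simp)
  have h := abs_divergence_le h1 z
  have h' := hM s hs z
  have := neg_abs_le (Torus.divergence (u s) z)
  linarith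

end Summit.AtomisticToContinuum.HydrodynamicLimit.Theorems

end
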